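import Mathlib
import Summits.Ventures.PercRepro2.Defs
import Summits.Ventures.PercRepro2.Graph
import Summits.Ventures.PercRepro2.OneColourSwitch
import Summits.Ventures.PercRepro2.RegionHubSign
import Summits.Ventures.PercRepro2.SideSwitch
import Summits.Ventures.PercRepro2.SideSwitchFibre
import Summits.Ventures.PercRepro2.SideSwitchClosed
import Summits.Ventures.PercRepro2.SideSwitchComps
import Summits.Ventures.PercRepro2.M9NoPocketDefs
import Summits.Ventures.PercRepro2.M9NoPocketWorld
import Summits.Ventures.PercRepro2.M9NoPocketWorldD
import Summits.Ventures.PercRepro2.M9NoPocketFibre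
import Summits.Ventures.PercRepro2.M9GeneralDSplit
import Summits.Ventures.PercRepro2.M9GeneralDHD
import Summits.Ventures.PercRepro2.M9SubcubeHarris
import Summits.Ventures.PercRepro2.M9ClusterFibreHarris
import Summits.Ventures.PercRepro2.M9PocketUnitFibre
import Summits.Ventures.PercRepro2.M9PocketUnitFibreSum
import Summits.Ventures.PercRepro2.M9PocketUnitKonly
import Summits.Ventures.PercRepro2.M9PocketPsi2
import Summits.Ventures.PercRepro2.M9PocketPsi2Sign
import Summits.Ventures.PercRepro2.M9PocketProdPoint
import Summits.Ventures.PercRepro2.M9PocketProdWorlds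
import Summits.Ventures.PercRepro2.M9PocketProdMono
import Summits.Ventures.PercRepro2.M9PocketProdSkel
import Summits.Ventures.PercRepro2.M9PocketProdFam
import Summits.Ventures.PercRepro2.M9PocketProdPartition
import Summits.Ventures.PercRepro2.M9PocketUnitFibreSumT
import Summits.Ventures.PercRepro2.M9PocketProdPointT
import Summits.Ventures.PercRepro2.M9PocketProdSkelT

/-!
# [`T`-edge chain] # The skeleton of a `K`-only point (blind cell PercRepro2, p3 g39 / g40, 2026-08-29;
`proofs/P3-POCKETRK.md` §10 (d): the free-block extension, part 9)

The SKELETON of a `K`-only legal point `ω`: switch its `W`-side to the `Y`-side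
(`M9PocketProdSkel`), then close every free edge (the edges not touching
`U = C_Y(d) ∪ K₂(G − d) ∪ M₂(G − d)` of the switched point).  The skeleton is a `K`-only
legal point without a `W`-side whose free edges are closed (`skel_legal`), it lies in the
exploration fibre of the switched point, and the `W`-side blocks of `ω` are switchable blocks
of the skeleton (`wside_block_mem_fam`).  T-VARIANT (p3 g39, `proofs/P3-POCKETRK.md` §10‴): the hypothesis «no `d r`, `d s` edge» is
replaced by `hM : d ∉ M₂(ρ)` (every `T`-edge is `Y` at a `K`-only point); the lemmas carry the
suffix `_T`, the `hT`-free lemmas are those of the original file.  Own work; std axioms.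
-/

namespace Summit.Ventures.PercRepro2

namespace NoPocket

open Finset Classical OneColourSwitch SideSwitch

variable {V : Type*} {E : Type*} {ends : E → Sym2 V} {p q r s d : V} {ω : Config E}

section Skel

variable (hdr : d ≠ r) (hds : d ≠ s) (hrs : within ends ({r, s} : Set V) = ∅)
  (hsep : sep2 ends p q r s ω) (hD : DOne ends r s d ω) (hK : d ∈ K2 ends r s ω)
  (hM : d ∉ M2 ends r s ω) (hp : p ≠ d) (hq : q ≠ d)

include hdr hds hrs hsep hD hK hM hp hq in
/-- **The skeleton is a `K`-only legal point without a `W`-side, with closed free edges.** -/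
lemma skel_legal_T :
    let ω₁ := flipTouch (endsD ends d) {x : V | x ∈ M2 (endsD ends d) r s ω ∧ x ≠ r ∧ x ≠ s} ω
    let ρ : Config E := fun e => if e ∈ touches ends (cluster ends ω₁ d ∪
      K2 (endsD ends d) r s ω₁ ∪ M2 (endsD ends d) r s ω₁) then ω₁ e else false
    sep2 ends p q r s ρ ∧ DOne ends r s d ρ ∧ d ∈ K2 ends r s ρ ∧ d ∉ M2 ends r s ρ ∧
      (∀ x ∈ M2 (endsD ends d) r s ρ, x = r ∨ x = s) ∧
      (cluster ends ρ d ∪ K2 (endsD ends d) r s ρ ∪ M2 (endsD ends d) r s ρ =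
        cluster ends ω₁ d ∪ K2 (endsD ends d) r s ω₁ ∪ M2 (endsD ends d) r s ω₁) ∧
      ∀ e ∉ touches ends (cluster ends ρ d ∪ K2 (endsD ends d) r s ρ ∪
        M2 (endsD ends d) r s ρ), ρ e = false := by
  intro ω₁ ρ
  obtain ⟨hsep₁, hD₁, hK₁, hM₁⟩ := norm_legal_T hdr hds hrs hsep hD hK hM hp hq
  have hB₁ : ∀ x ∈ M2 (endsD ends d) r s ω₁, x = r ∨ x = s := M2_endsD_norm hdr hds hsep hD
  -- `ρ` lies in the exploration fibre of `ω₁`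
  have hfib : ∀ e ∈ touches ends (cluster ends ω₁ d ∪ K2 (endsD ends d) r s ω₁ ∪
      M2 (endsD ends d) r s ω₁), ρ e = ω₁ e := by
    intro e he
    simp only [ρ, if_pos he]
  have hU := U_eq_on_unitFibre hdr hds hB₁ hfib
  refine ⟨(sep2_iff_on_unitFibre_T hdr hds hrs hM₁ hB₁ hfib).2 hsep₁,
    DOne_on_unitFibre_T hdr hds hrs hM₁ hB₁ hfib, ?_,
    d_notMem_M2_on_unitFibre_T hdr hds hrs hM₁ hB₁ hfib,
    M2_endsD_subset_on_unitFibre hdr hds hB₁ hfib, hU, ?_⟩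
  · rw [K2_eq_on_unitFibre hdr hds hB₁ hfib]; exact hK₁
  · intro e he
    rw [hU] at he
    simp only [ρ, if_neg he]

end Skel

section SkelProd

variable (hdr : d ≠ r) (hds : d ≠ s) (hrs : within ends ({r, s} : Set V) = ∅)
  {ρ : Config E} (hM : d ∉ M2 ends r s ρ)
  (hsep : sep2 ends p q r s ρ) (hD : DOne ends r s d ρ) (hK : d ∈ K2 ends r s ρ)
  (hB : ∀ x ∈ M2 (endsD ends d) r s ρ, x = r ∨ x = s)
  (hρR : ∀ e ∉ touches ends (cluster ends ρ d ∪ K2 (endsD ends d) r s ρ ∪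
    M2 (endsD ends d) r s ρ), ρ e = false)
  {𝔉 : Finset (Finset V)} {R : Finset E}
  (hR : ∀ e, e ∈ R ↔ e ∉ touches ends (cluster ends ρ d ∪ K2 (endsD ends d) r s ρ ∪
    M2 (endsD ends d) r s ρ))
  (h𝔉K : ∀ C ∈ 𝔉, (↑C : Set V) ⊆ K2 (endsD ends d) r s ρ)
  (h𝔉r : ∀ C ∈ 𝔉, r ∉ C) (h𝔉s : ∀ C ∈ 𝔉, s ∉ C)
  (h𝔉cl : ∀ C ∈ 𝔉, ClosedIn (endsD ends d) (sided (endsD ends d) r s ρ) (↑C : Set V))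
  (S : Finset ({C // C ∈ 𝔉} ⊕ {e // e ∈ R}))

include hdr hds hrs hM hsep hB hR h𝔉K h𝔉r h𝔉s h𝔉cl in
/-- The `W`-side of a point of the product fibre is its switched set. -/
lemma wside_prod_eq_T :
    {x : V | x ∈ M2 (endsD ends d) r s (flipTouch (endsD ends d)
      {x : V | ∃ c : {C // C ∈ 𝔉}, Sum.inl c ∈ S ∧ x ∈ c.1}
      (fun e => if h : e ∈ R then decide (Sum.inr ⟨e, h⟩ ∈ S) else ρ e)) ∧ x ≠ r ∧ x ≠ s} =
    {x : V | ∃ c : {C // C ∈ 𝔉}, Sum.inl c ∈ S ∧ x ∈ c.1} := by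
  ext x
  simp only [Set.mem_setOf_eq]
  rw [M2_endsD_prod_T hdr hds hrs hM hsep hB hR h𝔉K h𝔉r h𝔉s h𝔉cl S]
  constructor
  · rintro ⟨h, hxr, hxs⟩
    rcases h with h | h
    · rcases hB x h with h' | h'
      · exact (hxr h').elim
      · exact (hxs h').elim
    · exact h
  · intro h
    refine ⟨Or.inr h, ?_, ?_⟩
    · rintro rfl; obtain ⟨c, _, hc⟩ := h; exact h𝔉r c.1 c.2 hc
    · rintro rfl; obtain ⟨c, _, hc⟩ := h; exact h𝔉s c.1 c.2 hc

include hdr hds hrs hM hsep hB hρR hR h𝔉K h𝔉r h𝔉s h𝔉cl in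
/-- **The skeleton of a point of the product fibre is the skeleton it came from.** -/
lemma skel_prod_eq_T :
    let ω := flipTouch (endsD ends d)
      {x : V | ∃ c : {C // C ∈ 𝔉}, Sum.inl c ∈ S ∧ x ∈ c.1}
      (fun e => if h : e ∈ R then decide (Sum.inr ⟨e, h⟩ ∈ S) else ρ e)
    let ω₁ := flipTouch (endsD ends d) {x : V | x ∈ M2 (endsD ends d) r s ω ∧ x ≠ r ∧ x ≠ s} ω
    (fun e => if e ∈ touches ends (cluster ends ω₁ d ∪ K2 (endsD ends d) r s ω₁ ∪
      M2 (endsD ends d) r s ω₁) then ω₁ e else false) = ρ := by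
  intro ω ω₁
  have hW := wside_prod_eq_T hdr hds hrs hM hsep hB hR h𝔉K h𝔉r h𝔉s h𝔉cl S
  have hω₁ : ω₁ = (fun e => if h : e ∈ R then decide (Sum.inr ⟨e, h⟩ ∈ S) else ρ e) := by
    simp only [ω₁, ω]
    rw [hW, flipTouch_flipTouch]
  have hbase := base_eqOn_U (ρ := ρ) (r := r) (s := s) (d := d) hR S
  have hU := U_eq_on_unitFibre hdr hds hB hbase
  rw [hω₁, hU]
  funext e
  by_cases he : e ∈ touches ends (cluster ends ρ d ∪ K2 (endsD ends d) r s ρ ∪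
      M2 (endsD ends d) r s ρ)
  · rw [if_pos he]
    have : e ∉ R := fun h => (hR e).1 h he
    simp only [dif_neg this]
  · rw [if_neg he, hρR e he]

end SkelProd

section ProdSkel

variable (hdr : d ≠ r) (hds : d ≠ s) (hrs : within ends ({r, s} : Set V) = ∅)
  (hsep : sep2 ends p q r s ω) (hD : DOne ends r s d ω) (hK : d ∈ K2 ends r s ω)
  (hM : d ∉ M2 ends r s ω) (hp : p ≠ d) (hq : q ≠ d)
  {ρ : Config E}
  (hρ : ρ = fun e => if e ∈ touches ends
    (cluster ends (flipTouch (endsD ends d)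
        {x : V | x ∈ M2 (endsD ends d) r s ω ∧ x ≠ r ∧ x ≠ s} ω) d ∪
      K2 (endsD ends d) r s (flipTouch (endsD ends d)
        {x : V | x ∈ M2 (endsD ends d) r s ω ∧ x ≠ r ∧ x ≠ s} ω) ∪
      M2 (endsD ends d) r s (flipTouch (endsD ends d)
        {x : V | x ∈ M2 (endsD ends d) r s ω ∧ x ≠ r ∧ x ≠ s} ω)) then
      flipTouch (endsD ends d) {x : V | x ∈ M2 (endsD ends d) r s ω ∧ x ≠ r ∧ x ≠ s} ω e
    else false)
  {𝔉 : Finset (Finset V)} {R : Finset E}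
  (hR : ∀ e, e ∈ R ↔ e ∉ touches ends (cluster ends ρ d ∪ K2 (endsD ends d) r s ρ ∪
    M2 (endsD ends d) r s ρ))
  (h𝔉K : ∀ C ∈ 𝔉, (↑C : Set V) ⊆ K2 (endsD ends d) r s ρ)
  (hfam : ∀ x ∈ {x : V | x ∈ M2 (endsD ends d) r s ω ∧ x ≠ r ∧ x ≠ s},
    ∃ C ∈ 𝔉, x ∈ C ∧ (↑C : Set V) ⊆ {x : V | x ∈ M2 (endsD ends d) r s ω ∧ x ≠ r ∧ x ≠ s})

include hdr hds hsep hD hK hM hp hq hρ hR h𝔉K hfam in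
/-- **Every `K`-only legal point is the point of its skeleton's product fibre at its index**
(`S` = the blocks inside the `W`-side together with the open free edges). -/
lemma prod_index_eq_T (S : Finset ({C // C ∈ 𝔉} ⊕ {e // e ∈ R}))
    (hS : ∀ i : {C // C ∈ 𝔉} ⊕ {e // e ∈ R}, i ∈ S ↔
      (∀ c : {C // C ∈ 𝔉}, i = Sum.inl c →
        (↑c.1 : Set V) ⊆ {x : V | x ∈ M2 (endsD ends d) r s ω ∧ x ≠ r ∧ x ≠ s}) ∧
      ∀ e : {e // e ∈ R}, i = Sum.inr e → ω e.1 = true) :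
    flipTouch (endsD ends d)
      {x : V | ∃ c : {C // C ∈ 𝔉}, Sum.inl c ∈ S ∧ x ∈ c.1}
      (fun e => if h : e ∈ R then decide (Sum.inr ⟨e, h⟩ ∈ S) else ρ e) = ω := by
  rw [switched_index_eq hfam S hS]
  obtain ⟨hfib, hU⟩ := skel_fibre hdr hds hsep hD hρ
  funext e
  by_cases heR : e ∈ R
  · -- a free edge: its colour is read off `ω`
    have hnt : e ∉ touches (endsD ends d)
        {x : V | x ∈ M2 (endsD ends d) r s ω ∧ x ≠ r ∧ x ≠ s} := by
      rintro ⟨z, hz, w, hzw⟩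
      have hzd : z ≠ d := by rintro rfl; exact not_mem_M2_endsD hdr hds ω hz.1
      have hde : d ∉ ends e := by
        intro hde
        rw [endsD_of_mem hde, Sym2.eq_iff] at hzw
        rcases hzw with ⟨h1, _⟩ | ⟨_, h1⟩ <;> exact hzd h1.symm
      rw [endsD_of_notMem hde] at hzw
      apply (hR e).1 heR
      rw [hU]
      -- `z` is sided at `ω`, hence at the switched point (`K₂ ∪ W`)
      refine ⟨z, Or.inl (Or.inr ?_), w, hzw⟩
      rw [K2_endsD_norm hdr hds hsep hD]
      exact Or.inr hz
    rw [flipTouch_of_notMem _ hnt]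
    simp only [dif_pos heR]
    -- the membership reduces to `ω e = true`
    have hmem : (Sum.inr (⟨e, heR⟩ : {e // e ∈ R}) : {C // C ∈ 𝔉} ⊕ {e // e ∈ R}) ∈ S ↔
        ω e = true := by
      rw [hS]
      constructor
      · intro h'
        exact h'.2 ⟨e, heR⟩ rfl
      · intro h'
        refine ⟨fun c hc => (by cases hc), fun e' he' => ?_⟩
        have : e' = ⟨e, heR⟩ := (Sum.inr.inj he').symm
        rw [this]; exact h'
    rw [decide_eq_decide.2 hmem]
    exact Bool.decide_eq_true
  · have heU : e ∈ touches ends (cluster ends ρ d ∪ K2 (endsD ends d) r s ρ ∪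
        M2 (endsD ends d) r s ρ) := by
      by_contra h; exact heR ((hR e).2 h)
    rw [hU] at heU
    by_cases ht : e ∈ touches (endsD ends d)
        {x : V | x ∈ M2 (endsD ends d) r s ω ∧ x ≠ r ∧ x ≠ s}
    · rw [flipTouch_of_mem _ ht]
      simp only [dif_neg heR]
      rw [hfib e heU, flipTouch_of_mem _ ht, Bool.not_not]
    · rw [flipTouch_of_notMem _ ht]
      simp only [dif_neg heR]
      rw [hfib e heU, flipTouch_of_notMem _ ht]

end ProdSkel

section IndexProd

variable (hdr : d ≠ r) (hds : d ≠ s) (hrs : within ends ({r, s} : Set V) = ∅)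
  {ρ : Config E} (hM : d ∉ M2 ends r s ρ)
  (hsep : sep2 ends p q r s ρ) (hD : DOne ends r s d ρ)
  (hB : ∀ x ∈ M2 (endsD ends d) r s ρ, x = r ∨ x = s)
  {𝔉 : Finset (Finset V)} {R : Finset E}
  (hR : ∀ e, e ∈ R ↔ e ∉ touches ends (cluster ends ρ d ∪ K2 (endsD ends d) r s ρ ∪
    M2 (endsD ends d) r s ρ))
  (h𝔉K : ∀ C ∈ 𝔉, (↑C : Set V) ⊆ K2 (endsD ends d) r s ρ)
  (h𝔉r : ∀ C ∈ 𝔉, r ∉ C) (h𝔉s : ∀ C ∈ 𝔉, s ∉ C)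
  (h𝔉cl : ∀ C ∈ 𝔉, ClosedIn (endsD ends d) (sided (endsD ends d) r s ρ) (↑C : Set V))
  (hdisj : ∀ C ∈ 𝔉, ∀ C' ∈ 𝔉, C ≠ C' → Disjoint C C')
  (hne : ∀ C ∈ 𝔉, C.Nonempty)
  (S : Finset ({C // C ∈ 𝔉} ⊕ {e // e ∈ R}))

include hdr hds hrs hM hsep hB hR h𝔉K h𝔉r h𝔉s h𝔉cl hdisj hne in
/-- **The index of the point `φ S` is `S`**: a block is inside the `W`-side of `φ S` iff it is
switched, a free edge is open at `φ S` iff it is in `S`. -/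
lemma index_prod_iff_T (i : {C // C ∈ 𝔉} ⊕ {e // e ∈ R}) :
    i ∈ S ↔
      (∀ c : {C // C ∈ 𝔉}, i = Sum.inl c → (↑c.1 : Set V) ⊆
        {x : V | x ∈ M2 (endsD ends d) r s (flipTouch (endsD ends d)
          {x : V | ∃ c : {C // C ∈ 𝔉}, Sum.inl c ∈ S ∧ x ∈ c.1}
          (fun e => if h : e ∈ R then decide (Sum.inr ⟨e, h⟩ ∈ S) else ρ e)) ∧ x ≠ r ∧ x ≠ s}) ∧
      ∀ e : {e // e ∈ R}, i = Sum.inr e → flipTouch (endsD ends d)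
          {x : V | ∃ c : {C // C ∈ 𝔉}, Sum.inl c ∈ S ∧ x ∈ c.1}
          (fun e => if h : e ∈ R then decide (Sum.inr ⟨e, h⟩ ∈ S) else ρ e) e.1 = true := by
  have hW := wside_prod_eq_T hdr hds hrs hM hsep hB hR h𝔉K h𝔉r h𝔉s h𝔉cl S
  rw [hW]
  rcases i with c | e
  · constructor
    · intro hc
      refine ⟨fun c' hc' => ?_, fun e he => (by cases he)⟩
      have : c' = c := Sum.inl.inj hc'.symm
      rw [this]
      intro x hx
      exact ⟨c, hc, Finset.mem_coe.1 hx⟩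
    · rintro ⟨h, _⟩
      have hsub := h c rfl
      obtain ⟨x, hx⟩ := hne c.1 c.2
      obtain ⟨c', hc', hx'⟩ := hsub (Finset.mem_coe.2 hx)
      have : c = c' := by
        by_contra hcc
        exact Finset.disjoint_left.1 (hdisj c.1 c.2 c'.1 c'.2 (fun h' => hcc (Subtype.ext h')))
          hx hx'
      rw [this]; exact hc'
  · constructor
    · intro he
      refine ⟨fun c hc => (by cases hc), fun e' he' => ?_⟩
      have : e' = e := (Sum.inr.inj he').symm
      rw [this, prod_eq_of_mem_R S e.2 (notMem_touches_switched_of_mem_R hdr hds hR h𝔉K S e.2)]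
      simpa using he
    · rintro ⟨_, h⟩
      have := h e rfl
      rw [prod_eq_of_mem_R S e.2 (notMem_touches_switched_of_mem_R hdr hds hR h𝔉K S e.2)] at this
      simpa using this

end IndexProd

end NoPocket

end Summit.Ventures.PercRepro2
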